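import Mathlib

/-!
# Tier7/Line3/LevelFactorPositive — `b_γ₀` at the level place: the factor is a POSITIVE VOLUME for `N ≥ N₀`
(seat t7-x1, gen 3; wall-breaker row for the Line-3 record «`b_N(γ₀) ≠ 0`: volumes > 0» — memo v18 l. 99 («characters
locally constant ⇒ `O_{γ₀}(f_v) = vol(U_v ∩ …) > 0`», in words) and l. 427 (row `orb_γ₀ : ∀ N, O_{γ₀}(f_N) ≠ 0`);
p1's T7SupportLocalFactorPositive p664522 takes «the integrand equals the indicator of an open set» as its HYPOTHESIS)

LINE 3 (t7-plan-3), version (ii), the field `b_γ₀ : ∃ N₀, ∀ N ≥ N₀, b N γ₀ ≠ 0` of x1's `KappaData` (DominantSideOfKappa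
p677612) at the level place `v₁`. The twisted level-`N` factor at the dominant coset is
`b_{v₁,N}(γ₀) = ∫_A ∫_B χ_A(a) ψ_B(b) 1_{γ₀ K_N}(ι_A(a)⁻¹ γ₀ ι_B(b))`;
the recorded argument says «= vol > 0» — which presumes that the character factor is `1` wherever the indicator is.
This file DERIVES that, for `N ≥ N₀`, from three displayed local facts and nothing else — a different angle (topological:
local constancy + compactness + the central match) from the recorded one (the integrand equal to an indicator, assumed):
* the characters `χ_A`, `ψ_B` are LOCALLY CONSTANT (the characters of a `p`-adic torus are);
* the CENTRAL MATCH on the stabiliser: `ι_A(a)⁻¹ γ₀ ι_B(b) = γ₀ ⇒ χ_A(a) ψ_B(b) = 1` (for a regular `γ₀` the stabiliser of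
  the double coset is the diagonal centre, p1 rows 662/663, on which (C) `μ₀μ₁ = μ₂μ₃` gives the match);
* the levels `K_N` are OPEN subgroups, decreasing, with `⋂ K_N = {1}` (the principal congruence subgroups).
Then: `O := {χ_A(a) ψ_B(b) = 1}` is open and contains the stabiliser `Z`; the level sets `S_N = φ⁻¹(γ₀ K_N)` (`φ` the
orbit map) are closed (open subgroups are closed), decreasing, with `⋂ S_N ⊆ Z ⊆ O`; Cantor in the compact `A × B`
(`IsCompact.elim_directed_family_closed`) gives `S_{N₀} ⊆ O`; for `N ≥ N₀` the twisted integrand IS the indicator of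
`S_N`, so the factor is `(μ_A ⊗ μ_B)(S_N)` — `S_N` open (the levels are open), non-empty (`(1,1) ∈ S_N`), of finite
positive Haar measure (`eventually_levelFactor_eq_volume_and_ne_zero`).
PRECISION for the memo: row l. 427's `∀ N` is not right at the level place — at small levels the factor CAN vanish for
ramified characters (`N = 0`, `K_0 ⊇ ι_A(A), ι_B(B), γ₀`: `S_0 = A × B` and `∫ χ_A · ∫ ψ_B = 0` unless both characters
are trivial); the true statement is `∃ N₀, ∀ N ≥ N₀` — exactly `KappaData.b_γ₀`; the argument only uses large `N`.

The integrand below is LevelInvariantOrbital's `orbital μA μB ιA ιB χA ψB ((coset γ₀ (K N)).indicator 1) γ₀` unfolded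
(definitionally equal; stated self-contained so that this module does not wait for that module's olean).
DICTIONARY (in words, [M]-level, not distance to (P); TYPING-CENSUS T7): `A = T_A(F_{v₁})`, `B = T_B(F_{v₁})` compact
(`v₁` inert), Haar measures; `χ_A = μ_{A,v₁}`, `ψ_B = μ_{B,v₁}⁻¹`; `K_N` the principal congruence subgroups of `K₁`;
the stabiliser of the regular `γ₀` = the diagonal centre and (C) on it. Nothing here is about (N), (P), the real `X`,
or HC_CM; §8(d): NO. Blind lane: Mathlib only; no sorry; axioms ⊆ {propext, Classical.choice, Quot.sound}.
-/

namespace Summit.Ventures.HodgeRepro2.Tier7.Line3.LevelFactorPositive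

open MeasureTheory Topology

variable {A B G : Type*} [Group A] [Group B] [Group G]

/-! ## The level set, the stabiliser, the match set (algebra only) -/

/-- the ORBIT MAP `(a, b) ↦ ι_A(a)⁻¹ γ₀ ι_B(b)`. -/
def orbitMap (ιA : A →* G) (ιB : B →* G) (γ₀ : G) (p : A × B) : G := (ιA p.1)⁻¹ * γ₀ * ιB p.2

/-- the LEVEL SET `S_K = φ⁻¹(γ₀ K) = {(a, b) | γ₀⁻¹ ι_A(a)⁻¹ γ₀ ι_B(b) ∈ K}`. -/
def levelSet (ιA : A →* G) (ιB : B →* G) (γ₀ : G) (K : Subgroup G) : Set (A × B) :=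
  {p | γ₀⁻¹ * orbitMap ιA ιB γ₀ p ∈ K}

/-- the STABILISER `Z = φ⁻¹{γ₀}`. -/
def stab (ιA : A →* G) (ιB : B →* G) (γ₀ : G) : Set (A × B) := {p | orbitMap ιA ιB γ₀ p = γ₀}

/-- the MATCH SET `O = {χ_A(a) ψ_B(b) = 1}`. -/
def matchSet (χA : A →* ℂ) (ψB : B →* ℂ) : Set (A × B) := {p | χA p.1 * ψB p.2 = 1}

/-- `(1, 1)` lies in every level set. -/
theorem one_mem_levelSet (ιA : A →* G) (ιB : B →* G) (γ₀ : G) (K : Subgroup G) :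
    ((1 : A), (1 : B)) ∈ levelSet ιA ιB γ₀ K := by
  simp [levelSet, orbitMap, K.one_mem]

/-- the level sets DECREASE with the level. -/
theorem levelSet_antitone (ιA : A →* G) (ιB : B →* G) (γ₀ : G) (K : ℕ → Subgroup G) (hK : Antitone K) :
    Antitone fun N => levelSet ιA ιB γ₀ (K N) :=
  fun _ _ hNM _ hp => hK hNM hp

/-- with `⋂ K_N = {1}`, the intersection of the level sets lies in the stabiliser. -/
theorem iInter_levelSet_subset_stab (ιA : A →* G) (ιB : B →* G) (γ₀ : G) (K : ℕ → Subgroup G)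
    (hK1 : ∀ g, (∀ N, g ∈ K N) → g = 1) :
    (⋂ N, levelSet ιA ιB γ₀ (K N)) ⊆ stab ιA ιB γ₀ := by
  intro p hp
  have h1 : γ₀⁻¹ * orbitMap ιA ιB γ₀ p = 1 := hK1 _ (fun N => Set.mem_iInter.1 hp N)
  show orbitMap ιA ιB γ₀ p = γ₀
  calc orbitMap ιA ιB γ₀ p = γ₀ * (γ₀⁻¹ * orbitMap ιA ιB γ₀ p) := by group
    _ = γ₀ := by rw [h1, mul_one]

/-- the central match on the stabiliser puts the stabiliser inside the match set. -/
theorem stab_subset_matchSet (ιA : A →* G) (ιB : B →* G) (γ₀ : G) (χA : A →* ℂ) (ψB : B →* ℂ)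
    (hmatch : ∀ a b, (ιA a)⁻¹ * γ₀ * ιB b = γ₀ → χA a * ψB b = 1) :
    stab ιA ιB γ₀ ⊆ matchSet χA ψB :=
  fun p hp => hmatch p.1 p.2 hp

/-- **the twisted integrand IS the indicator of the level set** once the level set lies in the match set. -/
theorem integrand_eq_indicator (ιA : A →* G) (ιB : B →* G) (χA : A →* ℂ) (ψB : B →* ℂ) (γ₀ : G)
    (K : Subgroup G) (hsub : levelSet ιA ιB γ₀ K ⊆ matchSet χA ψB) (a : A) (b : B) :
    χA a * ψB b * ({g | γ₀⁻¹ * g ∈ K}.indicator (fun _ => (1 : ℂ))) ((ιA a)⁻¹ * γ₀ * ιB b)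
      = (levelSet ιA ιB γ₀ K).indicator (fun _ => (1 : ℂ)) (a, b) := by
  by_cases hp : (a, b) ∈ levelSet ιA ιB γ₀ K
  · have hg : (ιA a)⁻¹ * γ₀ * ιB b ∈ {g | γ₀⁻¹ * g ∈ K} := hp
    have hO : χA a * ψB b = 1 := hsub hp
    rw [Set.indicator_of_mem hg, Set.indicator_of_mem hp, hO, mul_one]
  · have hg : (ιA a)⁻¹ * γ₀ * ιB b ∉ {g | γ₀⁻¹ * g ∈ K} := hp
    rw [Set.indicator_of_notMem hg, Set.indicator_of_notMem hp, mul_zero]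

/-! ## Topology: open match set, open/closed level sets, Cantor -/

section Topology

variable [TopologicalSpace A] [TopologicalSpace B]

/-- the match set is OPEN for locally constant characters. -/
theorem isOpen_matchSet (χA : A →* ℂ) (ψB : B →* ℂ) (hχA : IsLocallyConstant (χA : A → ℂ))
    (hψB : IsLocallyConstant (ψB : B → ℂ)) : IsOpen (matchSet χA ψB) :=
  ((hχA.comp_continuous continuous_fst).mul (hψB.comp_continuous continuous_snd)).isOpen_fiber 1

variable [TopologicalSpace G] [IsTopologicalGroup G]

/-- the orbit map composed with `γ₀⁻¹ ·` is continuous for continuous `ι_A`, `ι_B`. -/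
theorem continuous_levelMap (ιA : A →* G) (ιB : B →* G) (hιA : Continuous ιA) (hιB : Continuous ιB)
    (γ₀ : G) : Continuous fun p : A × B => γ₀⁻¹ * orbitMap ιA ιB γ₀ p := by
  unfold orbitMap
  fun_prop

/-- the level set of an OPEN subgroup is open. -/
theorem isOpen_levelSet (ιA : A →* G) (ιB : B →* G) (hιA : Continuous ιA) (hιB : Continuous ιB) (γ₀ : G)
    (K : Subgroup G) (hK : IsOpen (K : Set G)) : IsOpen (levelSet ιA ιB γ₀ K) :=
  hK.preimage (continuous_levelMap ιA ιB hιA hιB γ₀)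

/-- the level set of an OPEN subgroup is closed (open subgroups are closed). -/
theorem isClosed_levelSet (ιA : A →* G) (ιB : B →* G) (hιA : Continuous ιA) (hιB : Continuous ιB) (γ₀ : G)
    (K : Subgroup G) (hK : IsOpen (K : Set G)) : IsClosed (levelSet ιA ιB γ₀ K) :=
  (K.isClosed_of_isOpen hK).preimage (continuous_levelMap ιA ιB hιA hιB γ₀)

/-- **CANTOR**: in the compact `A × B`, some level set already lies in the match set. -/
theorem exists_levelSet_subset_matchSet [CompactSpace A] [CompactSpace B] (ιA : A →* G) (ιB : B →* G)
    (hιA : Continuous ιA) (hιB : Continuous ιB) (χA : A →* ℂ) (ψB : B →* ℂ)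
    (hχA : IsLocallyConstant (χA : A → ℂ)) (hψB : IsLocallyConstant (ψB : B → ℂ)) (γ₀ : G)
    (hmatch : ∀ a b, (ιA a)⁻¹ * γ₀ * ιB b = γ₀ → χA a * ψB b = 1)
    (K : ℕ → Subgroup G) (hKopen : ∀ N, IsOpen (K N : Set G)) (hKanti : Antitone K)
    (hK1 : ∀ g, (∀ N, g ∈ K N) → g = 1) :
    ∃ N₀, levelSet ιA ιB γ₀ (K N₀) ⊆ matchSet χA ψB := by
  have hOc : IsCompact (matchSet χA ψB)ᶜ := (isOpen_matchSet χA ψB hχA hψB).isClosed_compl.isCompact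
  have hst : (matchSet χA ψB)ᶜ ∩ ⋂ N, levelSet ιA ιB γ₀ (K N) = ∅ := by
    rw [Set.eq_empty_iff_forall_notMem]
    rintro p ⟨hpO, hpS⟩
    exact hpO (stab_subset_matchSet ιA ιB γ₀ χA ψB hmatch
      (iInter_levelSet_subset_stab ιA ιB γ₀ K hK1 hpS))
  obtain ⟨N₀, hN₀⟩ := hOc.elim_directed_family_closed (fun N => levelSet ιA ιB γ₀ (K N))
    (fun N => isClosed_levelSet ιA ιB hιA hιB γ₀ (K N) (hKopen N)) hst
    (levelSet_antitone ιA ιB γ₀ K hKanti).directed_ge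
  refine ⟨N₀, fun p hp => ?_⟩
  by_contra hpO
  exact (Set.eq_empty_iff_forall_notMem.1 hN₀) p ⟨hpO, hp⟩

end Topology

/-! ## Measure: the factor is the volume of the open level set -/

section Measure

variable [TopologicalSpace A] [TopologicalSpace B] [TopologicalSpace G] [IsTopologicalGroup G]
  [MeasurableSpace A] [BorelSpace A] [SecondCountableTopology A]
  [MeasurableSpace B] [BorelSpace B] [SecondCountableTopology B]
  (μA : Measure A) [IsFiniteMeasure μA] (μB : Measure B) [IsFiniteMeasure μB]

/-- the iterated integral of the indicator of an open level set is its product-Haar volume. -/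
theorem integral_indicator_levelSet (ιA : A →* G) (ιB : B →* G) (hιA : Continuous ιA) (hιB : Continuous ιB)
    (γ₀ : G) (K : Subgroup G) (hK : IsOpen (K : Set G)) :
    (∫ a, ∫ b, (levelSet ιA ιB γ₀ K).indicator (fun _ => (1 : ℂ)) (a, b) ∂μB ∂μA)
      = ((μA.prod μB).real (levelSet ιA ιB γ₀ K) : ℂ) := by
  have hmeas : MeasurableSet (levelSet ιA ιB γ₀ K) :=
    (isOpen_levelSet ιA ιB hιA hιB γ₀ K hK).measurableSet
  have hint : Integrable ((levelSet ιA ιB γ₀ K).indicator fun _ => (1 : ℂ)) (μA.prod μB) :=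
    (integrable_const (1 : ℂ)).indicator hmeas
  rw [← integral_prod _ hint, integral_indicator_const (1 : ℂ) hmeas, Complex.real_smul, mul_one]

omit [BorelSpace A] [SecondCountableTopology A] [BorelSpace B] in
/-- the product-Haar volume of an open level set is a NON-ZERO real number. -/
theorem measureReal_levelSet_ne_zero [μA.IsOpenPosMeasure] [μB.IsOpenPosMeasure] (ιA : A →* G) (ιB : B →* G) (hιA : Continuous ιA) (hιB : Continuous ιB)
    (γ₀ : G) (K : Subgroup G) (hK : IsOpen (K : Set G)) :
    (μA.prod μB).real (levelSet ιA ιB γ₀ K) ≠ 0 := by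
  rw [measureReal_ne_zero_iff (measure_ne_top _ _)]
  exact (isOpen_levelSet ιA ιB hιA hιB γ₀ K hK).measure_ne_zero (μA.prod μB)
    ⟨((1 : A), (1 : B)), one_mem_levelSet ιA ιB γ₀ K⟩

/-- **`b_γ₀` AT THE LEVEL PLACE**: for locally constant characters with the central match on the stabiliser and a
decreasing tower of open subgroups shrinking to `1`, there is `N₀` such that for every `N ≥ N₀` the twisted level-`N`
factor at `γ₀` EQUALS the product-Haar volume of the open level set `S_N` — a non-zero real number. -/
theorem eventually_levelFactor_eq_volume_and_ne_zero [CompactSpace A] [CompactSpace B]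
    [μA.IsOpenPosMeasure] [μB.IsOpenPosMeasure] (ιA : A →* G) (ιB : B →* G)
    (hιA : Continuous ιA) (hιB : Continuous ιB) (χA : A →* ℂ) (ψB : B →* ℂ)
    (hχA : IsLocallyConstant (χA : A → ℂ)) (hψB : IsLocallyConstant (ψB : B → ℂ)) (γ₀ : G)
    (hmatch : ∀ a b, (ιA a)⁻¹ * γ₀ * ιB b = γ₀ → χA a * ψB b = 1)
    (K : ℕ → Subgroup G) (hKopen : ∀ N, IsOpen (K N : Set G)) (hKanti : Antitone K)
    (hK1 : ∀ g, (∀ N, g ∈ K N) → g = 1) :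
    ∃ N₀, ∀ N ≥ N₀,
      (∫ a, ∫ b, χA a * ψB b *
          ({g | γ₀⁻¹ * g ∈ K N}.indicator (fun _ => (1 : ℂ))) ((ιA a)⁻¹ * γ₀ * ιB b) ∂μB ∂μA)
        = ((μA.prod μB).real (levelSet ιA ιB γ₀ (K N)) : ℂ) ∧
      (μA.prod μB).real (levelSet ιA ιB γ₀ (K N)) ≠ 0 := by
  obtain ⟨N₀, hN₀⟩ := exists_levelSet_subset_matchSet ιA ιB hιA hιB χA ψB hχA hψB γ₀ hmatch K hKopen
    hKanti hK1
  refine ⟨N₀, fun N hN => ⟨?_, measureReal_levelSet_ne_zero μA μB ιA ιB hιA hιB γ₀ (K N) (hKopen N)⟩⟩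
  have hsub : levelSet ιA ιB γ₀ (K N) ⊆ matchSet χA ψB :=
    (levelSet_antitone ιA ιB γ₀ K hKanti hN).trans hN₀
  simp_rw [integrand_eq_indicator ιA ιB χA ψB γ₀ (K N) hsub]
  exact integral_indicator_levelSet μA μB ιA ιB hιA hιB γ₀ (K N) (hKopen N)

/-- the same, in the shape of `KappaData.b_γ₀`: `∃ N₀, ∀ N ≥ N₀, b N γ₀ ≠ 0` for the level factors. -/
theorem eventually_levelFactor_ne_zero [CompactSpace A] [CompactSpace B]
    [μA.IsOpenPosMeasure] [μB.IsOpenPosMeasure] (ιA : A →* G) (ιB : B →* G)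
    (hιA : Continuous ιA) (hιB : Continuous ιB) (χA : A →* ℂ) (ψB : B →* ℂ)
    (hχA : IsLocallyConstant (χA : A → ℂ)) (hψB : IsLocallyConstant (ψB : B → ℂ)) (γ₀ : G)
    (hmatch : ∀ a b, (ιA a)⁻¹ * γ₀ * ιB b = γ₀ → χA a * ψB b = 1)
    (K : ℕ → Subgroup G) (hKopen : ∀ N, IsOpen (K N : Set G)) (hKanti : Antitone K)
    (hK1 : ∀ g, (∀ N, g ∈ K N) → g = 1) :
    ∃ N₀, ∀ N ≥ N₀,
      (∫ a, ∫ b, χA a * ψB b *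
          ({g | γ₀⁻¹ * g ∈ K N}.indicator (fun _ => (1 : ℂ))) ((ιA a)⁻¹ * γ₀ * ιB b) ∂μB ∂μA) ≠ 0 := by
  obtain ⟨N₀, h⟩ := eventually_levelFactor_eq_volume_and_ne_zero μA μB ιA ιB hιA hιB χA ψB hχA hψB γ₀
    hmatch K hKopen hKanti hK1
  refine ⟨N₀, fun N hN => ?_⟩
  rw [(h N hN).1]
  exact Complex.ofReal_ne_zero.2 (h N hN).2

end Measure

end Summit.Ventures.HodgeRepro2.Tier7.Line3.LevelFactorPositive
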